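import Literature.MathematicalPhysics.QuantumFieldTheory.ConformalBootstrap3D.PointKernelK34L515.Cert

/-!
# K34L515 instance, cell `l6c1` (parts file: groups 0:32)

Kernel-v3 cell of the point-functional exclusion instance for the lower box `Δσ ∈ [0.515, 0.520]`,
`Δε ∈ [0.6, 0.95)` (certificate `certL515`, module `PointKernelK34L515.Cert`): spin `ℓ = 6`,
`Δ ∈ [57/8, 29/4)` (centre `A`, half-width `2^-4`), Taylor degree `4`, `n_F = 40`, `1` s-piece(s)
covering `s = Δσ ∈ [103/200, 13/25]`.  Group theorems `l6c1_part<i>_<a>_<b> : gPart … = some <literal>` are checked by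
`decide +kernel` (the literals were produced by `#eval` of the same function); the cell numbers `l6c1_num<i> ≥ 0`
likewise; `l6c1_block` is `PKTM.blockPositive_of_cellPass` applied to them. This file holds only group theorems (the cell stated as a literal); the final file of the cell imports it.  Generated by
`gen/mk_v3cell.py` / `gen/drive_v3.py` (typer-g8).  [folklore]
-/

set_option Elab.async false

namespace Literature.MathematicalPhysics.QuantumFieldTheory.ConformalBootstrap3D

namespace PointKernelK34L515

open PointKernel PKTM
open Literature.Analysis.ValidatedNumerics.PolyMP
open Literature.Analysis.ValidatedNumerics.NumericsMP

/-- group model literal [folklore] -/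
def l6c1_g0_32_34 : G3 := ([⟨539783847786032102189078573548026235236, 539783855797253667473913730141606676781⟩, ⟨59536456095724744727155019767318557107, 59536469236135570276311876976755294687⟩, ⟨-4053992934730684784546460193572932844, -4053974409565087132069685085495254675⟩, ⟨5247285899034374949598321454883315968, 5247305955947409319665943103311361213⟩, ⟨-4261608123162935115988607503759425192, -4261589842356693641704054444852269738⟩], [⟨-6508311882013771410739117479554397608, -6508311785630087776659822199017193627⟩, ⟨-710521444015024504039206527307433014, -710521285727303048157262354898102603⟩, ⟨45182805935292074141494406644702743, 45183029114368792718724114756020058⟩, ⟨-62030440175244009751581268882989792, -62030198513894428114610265650517690⟩, ⟨51040554480469909706655103769782181, 51040774767410945453630186217605132⟩], [⟨39680732571830845335117782908984906, 39680733159068968760758256601364496⟩, ⟨4319660452118730858936569972667841, 4319661417086255229481390839079079⟩, ⟨-267098545981832655473754283107248, -267097185224129425776861704486700⟩, ⟨375685582664338153785496986145047, 375687056326967316887559673754241⟩, ⟨-310477553969969117941847728545316, -310476210452155592909549530064915⟩])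

/-- group `[32, 34)` of piece 0 [folklore] -/
theorem l6c1_part0_32_34 : gPart certL515 (⟨6, ((115 : ℚ) / 16), 4, 4, 40, 6, 64, ⟨3, 0, 5, 76, 0, 0⟩⟩ : TMCell) (pc ps1 0) 32 34 = some l6c1_g0_32_34 := by decide +kernel

end PointKernelK34L515

end Literature.MathematicalPhysics.QuantumFieldTheory.ConformalBootstrap3D
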